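import Summits.ResolutionOfSingularities.ResolutionOfSingularities.Theorems.PurelyInseparableDim4AtlasMemberDefs
import Summits.ResolutionOfSingularities.ResolutionOfSingularities.Theorems.PurelyInseparableDim4JointHereditaryDefs
import HarnessLib

/-!
# Purely inseparable four-folds: ATLAS MEMBERS — unfolding lemmas and the bridge from single-chart members (brick S3 (c) v4, tranche 1,
# brick A0; cell `res-dim4-pi`)

[OURS · counted 0] (D-0157 DOOR 2; host item stmt-ResolutionOfSingularities-16155, helper). Nothing here proves resolution of
singularities in dimension ≥ 4 / characteristic `p`. Book-keeping for the v4 definitions (`…AtlasMemberDefs`, p711312):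

* §1 `mem_ownedSetZ_iff`, `ownedSetZ_empty` (no deferrals: the owned subspace is all of `V(z, x_T)`), `not_isEscaping_iff`,
  `sdiff_eq_empty_of_not_isEscaping`, `aedge_iff`, **`aedge_iff_of_forall_not_isEscaping`** (without escaping entries the atlas edge relation
  is v3's child-edge relation on main readings: no extra readings).
* §2 **`memberAtlasZ_singleton_of_memberChartZ`** — a SINGLE-CHART member of v3-H (`MemberChartZ`, any waiting data) is an atlas member with
  the one reading `(s, S, ∅, ∅)`: the zigzag chart is the atlas, the member is covered by the owned part `φ(ψ⁻¹ V(z, x_S))` because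
  `c ⊆ range φ` and `𝓘(c)` reads `𝓘Λ S`. (Root hosts and non-escaping children enter v4 through this bridge.)

AI-produced formalisation, weaker than expert review. bears_on: LADDER-RESOLUTION:D157-DOOR2 (res-dim4-pi · S3 (c) v4 basics).
-/

set_option linter.dupNamespace false -- D-0017: single-problem summit path `Summit.<S>.<S>.…` by design

noncomputable section

open MvPolynomial Finset CategoryTheory AlgebraicGeometry Opposite TopologicalSpace
open AlgebraicGeometry.Scheme.IdealSheafData (ofIdealTop vanishingIdeal)

namespace Summit.ResolutionOfSingularities.ResolutionOfSingularities.Theorems.PIDim4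

open Literature.AlgebraicGeometry.Resolution
open Literature.AlgebraicGeometry.Resolution.Hauser2010
open Literature.AlgebraicGeometry.Resolution.AffinePointBlowup (P A γ coord Wtop ξ)

namespace Equimultiple

/-! ## §1 Unfolding lemmas -/

section Unfold

variable {K : Type} [Field K] (p : ℕ) [DecidableEq K]

omit [DecidableEq K] in
/-- Membership in the owned subspace, unfolded. [folklore] -/
theorem mem_ownedSetZ_iff (T : Finset (Fin 4)) (Xd : Finset (Fin 4 × K)) (x : P 4 K) :
    x ∈ ownedSetZ T Xd ↔ x ∈ (AffineCoordBlowup.CΛ 4 K (insert 0 (Fin.succ '' (T : Set (Fin 4)))) : Set (P 4 K)) ∧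
      ∀ iv ∈ Xd, (MvPolynomial.X iv.1.succ - C iv.2 : A 4 K) ∈ x.asIdeal := Iff.rfl

omit [DecidableEq K] in
/-- Without deferrals a reading owns the whole of `V(z, x_T)`. [folklore] -/
theorem ownedSetZ_empty (T : Finset (Fin 4)) :
    ownedSetZ T (∅ : Finset (Fin 4 × K)) = (AffineCoordBlowup.CΛ 4 K (insert 0 (Fin.succ '' (T : Set (Fin 4)))) : Set (P 4 K)) := by
  ext x
  rw [mem_ownedSetZ_iff]
  exact ⟨fun h => h.1, fun h => ⟨h, fun iv hiv => absurd hiv (Finset.notMem_empty iv)⟩⟩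

omit [Field K] [DecidableEq K] in
/-- Non-escaping means `T ⊆ S″`. [folklore] -/
theorem not_isEscaping_iff (T : Finset (Fin 4)) (e : Fin 4 × (Fin 4 → K) × Finset (Fin 4)) :
    ¬ IsEscaping T e ↔ T ⊆ e.2.2 := not_not

omit [Field K] [DecidableEq K] in
/-- A non-escaping entry has no extra charts: `T ∖ S″ = ∅`. [folklore] -/
theorem sdiff_eq_empty_of_not_isEscaping {T : Finset (Fin 4)} {e : Fin 4 × (Fin 4 → K) × Finset (Fin 4)} (h : ¬ IsEscaping T e) :
    T \ e.2.2 = ∅ :=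
  Finset.sdiff_eq_empty_iff_subset.mpr ((not_isEscaping_iff T e).mp h)

/-- The atlas edge relation, unfolded. [folklore] -/
theorem aedge_iff (plan : AReading K → Finset (Fin 4 × (Fin 4 → K) × Finset (Fin 4))) (r' r : AReading K) :
    AEdge p plan r' r ↔ ∃ e ∈ plan r, r' = mainReading p r e ∨ ∃ l ∈ r.2.1 \ e.2.2, r' = extraReading p r e l := Iff.rfl

/-- **Without escaping entries the atlas forest has no extra readings**: `AEdge` from `r` is «`r′` is the main reading of an entry».
[cite: BierstoneGrigorievMilmanWlodarczyk2011, Def. 3.1.3] -/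
theorem aedge_iff_of_forall_not_isEscaping (plan : AReading K → Finset (Fin 4 × (Fin 4 → K) × Finset (Fin 4))) (r' r : AReading K)
    (h : ∀ e ∈ plan r, ¬ IsEscaping r.2.1 e) :
    AEdge p plan r' r ↔ ∃ e ∈ plan r, r' = mainReading p r e := by
  rw [aedge_iff]
  refine ⟨?_, fun ⟨e, he, hr⟩ => ⟨e, he, Or.inl hr⟩⟩
  rintro ⟨e, he, hr | ⟨l, hl, -⟩⟩
  · exact ⟨e, he, hr⟩
  · rw [sdiff_eq_empty_of_not_isEscaping (h e he)] at hl
    exact absurd hl (Finset.notMem_empty l)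

/-- The centre of the main reading is the entry's `S″`; its state is v3's child state. [folklore] -/
theorem mainReading_fst_snd (r : AReading K) (e : Fin 4 × (Fin 4 → K) × Finset (Fin 4)) :
    (mainReading p r e).1 = CentreBlowup.step p r.2.1 e.1 e.2.1 r.1 ∧ (mainReading p r e).2.1 = e.2.2 := ⟨rfl, rfl⟩

/-- The main reading of a non-escaping entry carries no bundle directions. [folklore] -/
theorem mainReading_directions_of_not_isEscaping (r : AReading K) {e : Fin 4 × (Fin 4 → K) × Finset (Fin 4)}
    (h : ¬ IsEscaping r.2.1 e) : (mainReading p r e).2.2.2 = ∅ :=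
  sdiff_eq_empty_of_not_isEscaping h

/-- The centre and the state of an extra reading. [folklore] -/
theorem extraReading_fst_snd (r : AReading K) (e : Fin 4 × (Fin 4 → K) × Finset (Fin 4)) (l : Fin 4) :
    (extraReading p r e l).1 = escState p r.2.1 l e.2.1 r.1 ∧ (extraReading p r e l).2.1 = insert l (e.2.2.erase e.1) := ⟨rfl, rfl⟩

end Unfold

/-! ## §2 Single-chart members are atlas members with one reading -/

section Bridge

variable {K : Type} [Field K] (p : ℕ) {X' : Scheme.{0}}

/-- **A single-chart member is an atlas member with the one reading `(s, S, ∅, ∅)`.** From v3-H's `MemberChartZ` (any waiting data): the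
zigzag chart is the atlas; the member is covered by `φ(ψ⁻¹ V(z, x_S))` because `c ⊆ range φ` and `𝓘(c)` reads `𝓘Λ S` through the zigzag.
[cite: BierstoneGrigorievMilmanWlodarczyk2011, Def. 3.1.3 (2), (4)] [cite: Hauser2010, §G] -/
theorem memberAtlasZ_singleton_of_memberChartZ (M' : MarkedIdeal X') (c : Closeds X') (s : State K) (S : Finset (Fin 4))
    (Wt : Finset (Fin 4 × (Fin 4 → K) × Finset (Fin 4))) (wreg : Fin 4 × (Fin 4 → K) × Finset (Fin 4) → Closeds X')
    (h : MemberChartZ p M' c s S Wt wreg) :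
    MemberAtlasZ p M' c ({(s, S, (∅ : Finset (Fin 4 × K)), (∅ : Finset (Fin 4)))} : Finset (AReading K)) := by
  obtain ⟨Y, φ, ψ, hφ, hψ, hM, hc, hcr, hsee, ⟨idx, cst_, hshape, hinj⟩, -⟩ := h
  have hr : ∀ r : ↥({(s, S, (∅ : Finset (Fin 4 × K)), (∅ : Finset (Fin 4)))} : Finset (AReading K)),
      (r : AReading K) = (s, S, (∅ : Finset (Fin 4 × K)), (∅ : Finset (Fin 4))) := fun r => Finset.mem_singleton.mp r.2
  refine ⟨fun _ => Y, fun _ => φ, fun _ => ψ, fun r => ?_, ?_, fun r r' hne => ?_⟩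
  · rw [hr r]
    exact ⟨hφ, hψ, hM, hc, hsee, idx, cst_, hshape, hinj⟩
  · -- the cover: `c ⊆ φ(ψ⁻¹ V(z, x_S))`
    intro x hx
    obtain ⟨y, rfl⟩ := hcr hx
    have hy : y ∈ ((vanishingIdeal c).comap φ).support := by
      rw [Scheme.IdealSheafData.support_comap]
      change φ y ∈ ((vanishingIdeal c).support : Set X')
      rw [Scheme.IdealSheafData.coe_support_vanishingIdeal]
      exact hx
    rw [hc, Scheme.IdealSheafData.support_comap] at hy
    change ψ y ∈ ((AffineCoordBlowup.𝓘Λ 4 K (insert 0 (Fin.succ '' (S : Set (Fin 4))))).support : Set (P 4 K)) at hy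
    rw [AffineCoordBlowup.support_𝓘Λ] at hy
    refine Set.mem_iUnion.mpr ⟨⟨_, Finset.mem_singleton_self _⟩, y, ?_, rfl⟩
    change y ∈ ψ ⁻¹' ownedSetZ S (∅ : Finset (Fin 4 × K))
    rw [ownedSetZ_empty]
    exact hy
  · exact absurd (Subtype.ext ((hr r).trans (hr r').symm)) hne

end Bridge

end Equimultiple

end Summit.ResolutionOfSingularities.ResolutionOfSingularities.Theorems.PIDim4

end
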